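import Summits.RiemannHypothesis.RiemannHypothesis.Theorems.SoloInformedGroundStateEquation
import Summits.RiemannHypothesis.RiemannHypothesis.Theorems.SoloInformedGroundStatePairing
import Literature.NumberTheory.LFunctions.WeilMellinPolyDecay
import HarnessLib

/-!
# The honest pairing: a ground state is a weak eigenfunction, `W(u ⋆ h̃) = ε(a) ⟨u, h⟩`

Solo programme `solo-RiemannHypothesis-informed`, session 25 (part 2 of the Euler–Lagrange step;
part 1 is `SoloInformedGroundStateEquation.lean`).  Everything here is proved unconditionally.

For `u ∈ L²` vanishing a.e. off the window `[-a, a]` and a test `h`, the convolution `u ⋆ h̃` is a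
genuine Weil test function (smooth, compactly supported), so `W(u ⋆ h̃)` is an honest complex number —
the distribution `W` convolved with `u`, tested against `h`.  Through the explicit formula
(`explicit_formula_holds`, no Riemann hypothesis) and the window bound
`|v̂(ρ)| ≤ e^{a/2} √(2a) ‖v‖₂` in the critical strip, the map `v ↦ W(v ⋆ h̃)` is `L²`-Lipschitz on
window functions (`exists_norm_weilFunctional_weilConv_le`).  Passing to the limit in the weak
Euler–Lagrange equation along a minimising sequence (`tendsto_weilCross_of_minimizing`) gives, for every
normalised minimising sequence of window tests `gₙ → u` in `L²` — in particular for every ground state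
`IsWeilGroundState a u` — and every test `h` supported in `[-a, a]`:

  `W(u ⋆ h̃) = ε(a) · ∫ u · conj h`                     (`weilFunctional_weilConv_groundState`),

Bombieri's variational equation (2000, Lemma 1, (4.2)) in the operator-free encoding.  At an ONSET
`a₀` of negativity of `ε` (`IsWeilOnset a₀`, `ε(a₀) = 0`) every ground state `u` is therefore a nonzero
`L²` function on the window with `W(u ⋆ h̃) = 0` for ALL window tests `h`: a null vector of the
truncated Weil convolution (`weilFunctional_weilConv_eq_zero_of_onset`).  Consequently
(`riemannHypothesis_of_weilConv_injective`): if ground states exist on the windows `a ≥ log 3 / 2`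
(Bombieri 2000 Thm. 3; hypothesis) and on each such window the only `u ∈ L²(-a, a)` with
`W(u ⋆ h̃) = 0` for all window tests `h` is `u = 0` a.e., then the Riemann hypothesis holds.

References: E. Bombieri, *Remarks on Weil's quadratic functional in the theory of prime numbers, I*,
Rend. Lincei (9) 11 (2000), §4 [Bombieri2000Weil].
-/

noncomputable section

open Complex Filter Set Topology MeasureTheory
open Literature.NumberTheory.LFunctions
open Literature.NumberTheory.LFunctions.ConnesVanSuijlekom
open scoped ComplexConjugate Convolution

namespace Summit.RiemannHypothesis.RiemannHypothesis.Theorems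

variable {a : ℝ} {g h u v w : ℝ → ℂ}

/-! ## `L²` window functions: tests after convolution, transforms, integrability -/

/-- `v ⋆ k` is a Weil test function for `v ∈ L²` of compact support and a test `k`
(`HasCompactSupport.contDiff_convolution_right`, `HasCompactSupport.convolution`). [folklore] -/
theorem isWeilTest_weilConv_of_memLp (hv : MemLp v 2) (hvc : HasCompactSupport v) {k : ℝ → ℂ}
    (hk : IsWeilTest k) : IsWeilTest (weilConv v k) := by
  rw [weilConv_eq_convolution_real]
  exact ⟨hk.2.contDiff_convolution_right (ContinuousLinearMap.mul ℝ ℂ)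
      (hv.locallyIntegrable one_le_two) hk.1,
    HasCompactSupport.convolution (L := ContinuousLinearMap.mul ℝ ℂ) hvc hk.2⟩

/-- `(g - v) ⋆ k = g ⋆ k - v ⋆ k` for a test `g`, `v ∈ L²` and a test `k` (both convolutions exist). [folklore] -/
theorem weilConv_sub_left_of_memLp (hg : IsWeilTest g) (hv : MemLp v 2) {k : ℝ → ℂ}
    (hk : IsWeilTest k) : weilConv (g - v) k = weilConv g k - weilConv v k := by
  have hneg : -v = fun t ↦ (-1 : ℂ) * v t := by funext t; simp
  have h1 : weilConv (g - v) k = weilConv (g + fun t ↦ (-1 : ℂ) * v t) k := by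
    rw [← hneg, sub_eq_add_neg]
  have hvl : LocallyIntegrable (fun t ↦ (-1 : ℂ) * v t) :=
    (hv.const_mul (-1 : ℂ)).locallyIntegrable one_le_two
  rw [h1, weilConv,
    ConvolutionExists.add_distrib
      (hk.2.convolutionExists_right _ hg.1.continuous.locallyIntegrable hk.1.continuous)
      (hk.2.convolutionExists_right _ hvl hk.1.continuous)]
  change weilConv g k + weilConv (fun t ↦ (-1 : ℂ) * v t) k = weilConv g k - weilConv v k
  rw [weilConv_const_mul_left, sub_eq_add_neg]
  congr 1
  funext t
  simp

/-- `W(k₁ - k₂) = W(k₁) - W(k₂)` for tests. [folklore] -/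
theorem weilFunctional_sub (hk₁ : IsWeilTest g) (hk₂ : IsWeilTest h) :
    weilFunctional (g - h) = weilFunctional g - weilFunctional h := by
  have hneg : g - h = g + fun t ↦ (-1 : ℂ) * h t := by
    funext t; simp [sub_eq_add_neg]
  rw [hneg, weilFunctional_add hk₁ (hk₂.const_mul (-1)), weilFunctional_const_mul]
  ring

/-- Integrability of `t ↦ v(t) e^{ct}` for `v ∈ L²` vanishing a.e. off the window. [folklore] -/
theorem integrable_mul_cexp_of_memLp (hv : MemLp v 2) (hva : ∀ᵐ t : ℝ, t ∉ Icc (-a) a → v t = 0)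
    (c : ℂ) : Integrable fun t : ℝ ↦ v t * cexp (c * t) := by
  have hint : IntegrableOn v (Icc (-a) a) := (hv.restrict (Icc (-a) a)).integrable one_le_two
  have hprod : IntegrableOn (fun t : ℝ ↦ v t * cexp (c * t)) (Icc (-a) a) :=
    hint.mul_continuousOn (Continuous.continuousOn (by fun_prop)) isCompact_Icc
  exact hprod.integrable_of_ae_notMem_eq_zero (hva.mono fun t ht hnot ↦ by simp [ht hnot])

/-- A test function vanishing off the window: integrability of `t ↦ k(t) e^{ct}`. [folklore] -/
theorem integrable_mul_cexp_of_isWeilTest {k : ℝ → ℂ} (hk : IsWeilTest k) (c : ℂ) :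
    Integrable fun t : ℝ ↦ k t * cexp (c * t) :=
  (hk.1.continuous.mul (by fun_prop)).integrable_of_hasCompactSupport hk.2.mul_right

/-- **Multiplicativity of the transform, integrable form**: `(g ⋆ h)^(s) = ĝ(s) ĥ(s)` as soon as
`t ↦ g(t) e^{(s-1/2)t}` and `t ↦ h(t) e^{(s-1/2)t}` are integrable (Fubini, `integral_convolution`;
the computation of `weilMellin_weilConv_holds` with continuity replaced by integrability). [folklore] -/
theorem weilMellin_weilConv_of_integrable (s : ℂ)
    (hG : Integrable fun t : ℝ ↦ g t * cexp ((s - 1 / 2) * t))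
    (hH : Integrable fun t : ℝ ↦ h t * cexp ((s - 1 / 2) * t)) :
    weilMellin (weilConv g h) s = weilMellin g s * weilMellin h s := by
  set c : ℂ := s - 1 / 2 with hc
  set G : ℝ → ℂ := fun u ↦ g u * cexp (c * u) with hGdef
  set H : ℝ → ℂ := fun u ↦ h u * cexp (c * u) with hHdef
  have key : ∀ t : ℝ, weilConv g h t * cexp (c * t) = (G ⋆[ContinuousLinearMap.mul ℂ ℂ] H) t := by
    intro t
    rw [weilConv_apply, convolution_def, ← integral_mul_const]
    congr 1 with u
    simp only [hGdef, hHdef, ContinuousLinearMap.mul_apply']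
    have he : cexp (c * t) = cexp (c * u) * cexp (c * ((t - u : ℝ) : ℂ)) := by
      rw [← Complex.exp_add]
      push_cast
      ring_nf
    rw [he]
    ring
  have hL : weilMellin (weilConv g h) s = ∫ t : ℝ, (G ⋆[ContinuousLinearMap.mul ℂ ℂ] H) t := by
    unfold weilMellin
    exact integral_congr_ae (Eventually.of_forall fun t ↦ key t)
  rw [hL, integral_convolution (ContinuousLinearMap.mul ℂ ℂ) hG hH, ContinuousLinearMap.mul_apply']
  rfl

/-- **Window bound in the strip, `L²` form**: for `v ∈ L²` vanishing a.e. off `[-a, a]`,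
`|v̂(s)| ≤ e^{|Re s - 1/2| a} √(2a) ‖v‖₂`. [folklore] -/
theorem norm_weilMellin_le_window_of_memLp (hv : MemLp v 2)
    (hva : ∀ᵐ t : ℝ, t ∉ Icc (-a) a → v t = 0) (ha : 0 ≤ a) (s : ℂ) :
    ‖weilMellin v s‖ ≤
      Real.exp (|s.re - 1 / 2| * a) * (Real.sqrt (2 * a) * Real.sqrt (∫ t, ‖v t‖ ^ 2)) := by
  have key := norm_weilMellin_le_of_ae_vanish ha hv hva (-I * (s - 1 / 2))
  have hs : (1 / 2 : ℂ) + I * (-I * (s - 1 / 2)) = s := by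
    have : I * (-I * (s - 1 / 2)) = s - 1 / 2 := by
      rw [← mul_assoc, mul_neg, I_mul_I, neg_neg, one_mul]
    rw [this]
    ring
  have him : (-I * (s - 1 / 2)).im = -(s.re - 1 / 2) := by
    simp [mul_im]
  rw [hs, him, abs_neg] at key
  exact key

/-- In the open critical strip: `|v̂(ρ)| ≤ e^{a/2} √(2a) ‖v‖₂` for `0 < Re ρ < 1`. [folklore] -/
theorem norm_weilMellin_le_of_memLp_strip (hv : MemLp v 2)
    (hva : ∀ᵐ t : ℝ, t ∉ Icc (-a) a → v t = 0) (ha : 0 ≤ a) {ρ : ℂ} (h0 : 0 < ρ.re)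
    (h1 : ρ.re < 1) :
    ‖weilMellin v ρ‖ ≤ Real.exp (a / 2) * (Real.sqrt (2 * a) * Real.sqrt (∫ t, ‖v t‖ ^ 2)) := by
  refine (norm_weilMellin_le_window_of_memLp hv hva ha ρ).trans
    (mul_le_mul_of_nonneg_right (Real.exp_le_exp.2 ?_) (by positivity))
  have hle : |ρ.re - 1 / 2| ≤ 1 / 2 := abs_le.2 ⟨by linarith, by linarith⟩
  nlinarith [mul_nonneg (sub_nonneg.2 hle) ha]

/-! ## `L²`-continuity of `v ↦ W(v ⋆ h̃)` through the explicit formula -/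

/-- **Truncated zero side of `v ⋆ k` for an `L²` window function `v` and a test `k`**:
`|Σ_{|Im ρ| ≤ T} m(ρ) (v ⋆ k)^(ρ)| ≤ e^{a/2}√(2a)‖v‖₂ · Σ_{|Im ρ| ≤ T} m(ρ) |k̂(ρ)|`. [new] -/
theorem norm_weilZeroSidePartial_weilConv_le_of_memLp (hv : MemLp v 2)
    (hva : ∀ᵐ t : ℝ, t ∉ Icc (-a) a → v t = 0) (ha : 0 ≤ a) {k : ℝ → ℂ} (hk : IsWeilTest k)
    (T : ℝ) :
    ‖weilZeroSidePartial (weilConv v k) T‖ ≤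
      Real.exp (a / 2) * (Real.sqrt (2 * a) * Real.sqrt (∫ t, ‖v t‖ ^ 2)) *
        ∑ᶠ ρ ∈ weilZeroIndex T, (riemannZetaZeroOrder ρ : ℝ) * ‖weilMellin k ρ‖ := by
  set E : ℝ := Real.exp (a / 2) * (Real.sqrt (2 * a) * Real.sqrt (∫ t, ‖v t‖ ^ 2)) with hE
  have hfin := weilZeroIndex_finite T
  have hmem : ∀ ρ, ρ ∈ hfin.toFinset ↔ ρ ∈ weilZeroIndex T := fun ρ ↦ hfin.mem_toFinset
  unfold weilZeroSidePartial
  rw [finsum_mem_eq_finite_toFinset_sum _ hfin, finsum_mem_eq_finite_toFinset_sum _ hfin,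
    Finset.mul_sum]
  refine (norm_sum_le _ _).trans (Finset.sum_le_sum fun ρ hρ ↦ ?_)
  have hρ' := (hmem ρ).1 hρ
  have hm := riemannZetaZeroOrder_nonneg_of_mem_weilZeroIndex hρ'
  obtain ⟨h0, h1⟩ := re_pos_and_lt_one_of_mem_weilZeroIndex hρ'
  have hb := norm_weilMellin_le_of_memLp_strip hv hva ha h0 h1
  rw [weilMellin_weilConv_of_integrable ρ (integrable_mul_cexp_of_memLp hv hva _)
      (integrable_mul_cexp_of_isWeilTest hk _),
    norm_mul, norm_mul, Complex.norm_intCast, abs_of_nonneg hm]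
  calc (riemannZetaZeroOrder ρ : ℝ) * (‖weilMellin v ρ‖ * ‖weilMellin k ρ‖)
      ≤ (riemannZetaZeroOrder ρ : ℝ) * (E * ‖weilMellin k ρ‖) := by gcongr
    _ = E * ((riemannZetaZeroOrder ρ : ℝ) * ‖weilMellin k ρ‖) := by ring

/-- A uniform bound for the `ℓ¹` zero sums of a test: `Z₁(k; T) ≤ A` for all `T`
(polynomial decay of `k̂` in the strip and the unconditional `weilZeroSummable`). [folklore] -/
theorem exists_zeroSumAbs_le {k : ℝ → ℂ} (hk : IsWeilTest k) :
    ∃ A : ℝ, 0 ≤ A ∧ ∀ T : ℝ,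
      ∑ᶠ ρ ∈ weilZeroIndex T, (riemannZetaZeroOrder ρ : ℝ) * ‖weilMellin k ρ‖ ≤ A := by
  obtain ⟨D, hD0, hD⟩ := norm_weilMellin_le_pow_of_abs_re_le hk (1 / 2) 2
  refine ⟨D * ∑' ρ : ZetaZeros.riemannZetaNontrivialZeros, weilZeroWeight (ρ : ℂ),
    mul_nonneg hD0 tsum_weilZeroWeight_nonneg, fun T ↦ zeroSumAbs_le_of_norm_le (fun ρ hρ ↦ ?_) T⟩
  obtain ⟨-, hre, hre1⟩ := mem_riemannZetaNontrivialZeros_iff_holds.1 hρ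
  exact hD ρ (abs_le.2 ⟨by linarith, by linarith⟩)

/-- **`L²`-continuity of the cross term through the explicit formula.**  For a test `k` there is
`M ≥ 0` with `|W(v ⋆ k)| ≤ M ‖v‖₂` for every compactly supported `v ∈ L²` vanishing a.e. off
`[-a, a]` (the truncated zero sums converge to `W(v ⋆ k)` by `explicit_formula_holds`, `v ⋆ k` being a
test). [new] -/
theorem exists_norm_weilFunctional_weilConv_le (ha : 0 ≤ a) {k : ℝ → ℂ} (hk : IsWeilTest k) :
    ∃ M : ℝ, 0 ≤ M ∧ ∀ v : ℝ → ℂ, MemLp v 2 → HasCompactSupport v →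
      (∀ᵐ t : ℝ, t ∉ Icc (-a) a → v t = 0) →
        ‖weilFunctional (weilConv v k)‖ ≤ M * Real.sqrt (∫ t, ‖v t‖ ^ 2) := by
  obtain ⟨A, hA0, hA⟩ := exists_zeroSumAbs_le hk
  refine ⟨Real.exp (a / 2) * Real.sqrt (2 * a) * A, by positivity, fun v hv hvc hva ↦ ?_⟩
  have htest : IsWeilTest (weilConv v k) := isWeilTest_weilConv_of_memLp hv hvc hk
  have hlim : Tendsto (fun T ↦ ‖weilZeroSidePartial (weilConv v k) T‖) atTop
      (𝓝 ‖weilFunctional (weilConv v k)‖) :=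
    (continuous_norm.tendsto _).comp (explicit_formula_holds htest)
  refine le_of_tendsto' hlim fun T ↦ (norm_weilZeroSidePartial_weilConv_le_of_memLp hv hva ha hk T).trans ?_
  have hE0 : 0 ≤ Real.exp (a / 2) * (Real.sqrt (2 * a) * Real.sqrt (∫ t, ‖v t‖ ^ 2)) := by
    positivity
  calc Real.exp (a / 2) * (Real.sqrt (2 * a) * Real.sqrt (∫ t, ‖v t‖ ^ 2)) *
        ∑ᶠ ρ ∈ weilZeroIndex T, (riemannZetaZeroOrder ρ : ℝ) * ‖weilMellin k ρ‖
      ≤ Real.exp (a / 2) * (Real.sqrt (2 * a) * Real.sqrt (∫ t, ‖v t‖ ^ 2)) * A :=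
        mul_le_mul_of_nonneg_left (hA T) hE0
    _ = Real.exp (a / 2) * Real.sqrt (2 * a) * A * Real.sqrt (∫ t, ‖v t‖ ^ 2) := by ring

/-! ## The weak eigen-equation with the honest pairing -/

/-- The window representative `𝟙_{[-a,a]} · u` of an `L²` function vanishing a.e. off the window. -/
theorem indicator_window_ae_eq (hua : ∀ᵐ t : ℝ, t ∉ Icc (-a) a → u t = 0) :
    (Icc (-a) a).indicator u =ᵐ[volume] u := by
  filter_upwards [hua] with t ht
  by_cases h : t ∈ Icc (-a) a
  · simp [Set.indicator_of_mem h]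
  · rw [Set.indicator_of_notMem h, ht h]

/-- **The weak Euler–Lagrange equation with the honest pairing.**  Let `gₙ` be normalised window tests
with `Re Q(gₙ) → ε(a)` converging in `L²` to `u ∈ L²`, `u` vanishing a.e. off `[-a, a]`.  Then for
every test `h` supported in `[-a, a]`:  `W(u ⋆ h̃) = ε(a) · ∫ u · conj h`. [new] -/
theorem weilFunctional_weilConv_of_minimizing (ha : 0 < a) (g : ℕ → ℝ → ℂ)
    (hg : ∀ n, IsWeilTest (g n)) (hgs : ∀ n, tsupport (g n) ⊆ Icc (-a) a)
    (hg1 : ∀ n, ∫ t, ‖g n t‖ ^ 2 = (1 : ℝ))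
    (hQ : Tendsto (fun n ↦ (weilQuadratic (g n)).re) atTop (𝓝 (weilGroundEnergy a)))
    (hu : MemLp u 2) (hua : ∀ᵐ t : ℝ, t ∉ Icc (-a) a → u t = 0)
    (hgu : Tendsto (fun n ↦ ∫ t, ‖g n t - u t‖ ^ 2) atTop (𝓝 0))
    (hh : IsWeilTest h) (hhs : tsupport h ⊆ Icc (-a) a) :
    weilFunctional (weilConv u (weilReflect h)) =
      (weilGroundEnergy a : ℂ) * ∫ t, u t * conj (h t) := by
  -- the window representative
  set u' : ℝ → ℂ := (Icc (-a) a).indicator u with hu'def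
  have hae : u' =ᵐ[volume] u := indicator_window_ae_eq hua
  have hu' : MemLp u' 2 := hu.ae_eq hae.symm
  have hu'c : HasCompactSupport u' :=
    HasCompactSupport.intro isCompact_Icc fun t ht ↦ Set.indicator_of_notMem ht _
  have hu'a : ∀ᵐ t : ℝ, t ∉ Icc (-a) a → u' t = 0 :=
    Eventually.of_forall fun t ht ↦ Set.indicator_of_notMem ht _
  have hconv : weilConv u (weilReflect h) = weilConv u' (weilReflect h) := by
    -- (the convolution only sees the a.e. class of `u`; cf. the tree's `GroundBartaFloor.gbf_weilConv_congr_ae_left`)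
    funext t
    rw [weilConv_apply, weilConv_apply]
    exact integral_congr_ae (hae.symm.mono fun s hs ↦ by simp only [hs])
  have hinner : ∫ t, u t * conj (h t) = ∫ t, u' t * conj (h t) :=
    integral_congr_ae (hae.symm.mono fun t ht ↦ by simp only [ht])
  have hgu' : Tendsto (fun n ↦ ∫ t, ‖g n t - u' t‖ ^ 2) atTop (𝓝 0) := by
    exact hgu.congr (fun n ↦ integral_congr_ae (hae.mono fun t ht ↦ by simp only [ht]))
  rw [hconv, hinner]
  -- limit 1: the Euler–Lagrange equation along the sequence
  have hlim1 := tendsto_weilCross_of_minimizing g hg hgs hg1 hQ hu' hgu' hh hhs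
  -- limit 2: `L²`-continuity
  have hh' := hh.weilReflect
  obtain ⟨M, hM0, hM⟩ := exists_norm_weilFunctional_weilConv_le ha.le hh'
  have htest_u : IsWeilTest (weilConv u' (weilReflect h)) := isWeilTest_weilConv_of_memLp hu' hu'c hh'
  have hlim2 : Tendsto (fun n ↦ weilFunctional (weilConv (g n) (weilReflect h))) atTop
      (𝓝 (weilFunctional (weilConv u' (weilReflect h)))) := by
    rw [tendsto_iff_norm_sub_tendsto_zero]
    have hbd : ∀ n, ‖weilFunctional (weilConv (g n) (weilReflect h)) -
        weilFunctional (weilConv u' (weilReflect h))‖ ≤ M * Real.sqrt (∫ t, ‖g n t - u' t‖ ^ 2) := by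
      intro n
      have hw : MemLp (g n - u') 2 := (isWeilTest_memLp (hg n)).sub hu'
      have hwc : HasCompactSupport (g n - u') := (hg n).2.sub hu'c
      have hwa : ∀ᵐ t : ℝ, t ∉ Icc (-a) a → (g n - u') t = 0 :=
        Eventually.of_forall fun t ht ↦ by
          rw [Pi.sub_apply, image_eq_zero_of_notMem_tsupport (fun h' ↦ ht (hgs n h')), hu'def,
            Set.indicator_of_notMem ht, sub_zero]
      have := hM (g n - u') hw hwc hwa
      rwa [weilConv_sub_left_of_memLp (hg n) hu' hh',
        weilFunctional_sub ((hg n).weilConv hh') htest_u] at this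
    refine squeeze_zero_norm (fun n ↦ by simpa using hbd n) ?_
    have := (hgu'.sqrt).const_mul M
    simpa using this
  exact tendsto_nhds_unique hlim2 hlim1

/-- **A ground state is a weak eigenfunction of the truncated Weil form** (Bombieri 2000, (4.2)):
`W(u ⋆ h̃) = ε(a) ⟨u, h⟩` for every test `h` supported in `[-a, a]`. [new] -/
theorem weilFunctional_weilConv_groundState (hu : IsWeilGroundState a u) (hh : IsWeilTest h)
    (hhs : tsupport h ⊆ Icc (-a) a) :
    weilFunctional (weilConv u (weilReflect h)) =
      (weilGroundEnergy a : ℂ) * ∫ t, u t * conj (h t) := by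
  have ha := hu.pos
  have hua := hu.ae_eq_zero_of_notMem
  obtain ⟨hu2, g, hg, hQ, hgu⟩ := hu
  exact weilFunctional_weilConv_of_minimizing ha g (fun n ↦ (hg n).1) (fun n ↦ (hg n).2.1)
    (fun n ↦ (hg n).2.2) hQ hu2 hua hgu hh hhs

/-- **At an onset every ground state is a null vector of the truncated Weil convolution**:
`IsWeilOnset a₀`, `IsWeilGroundState a₀ u` ⟹ `W(u ⋆ h̃) = 0` for every test `h` supported in
`[-a₀, a₀]` (and `u ≠ 0`, `‖u‖₂ = 1`, `u = 0` a.e. off the window). [new] -/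
theorem weilFunctional_weilConv_eq_zero_of_onset {a₀ : ℝ} (ha₀ : IsWeilOnset a₀)
    (hu : IsWeilGroundState a₀ u) (hh : IsWeilTest h) (hhs : tsupport h ⊆ Icc (-a₀) a₀) :
    weilFunctional (weilConv u (weilReflect h)) = 0 := by
  rw [weilFunctional_weilConv_groundState hu hh hhs, ha₀.eq_zero, Complex.ofReal_zero, zero_mul]

/-- **A failure of RH produces a nonzero `W`-null window function** (given ground states): at the
onset `a₀ ≥ log 3 / 2`, any ground state `u` has `‖u‖₂ = 1` and `W(u ⋆ h̃) = 0` for all window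
tests. [new] -/
theorem exists_weilWindowNull_of_not_riemannHypothesis
    (hex : ∀ a : ℝ, Real.log 3 / 2 ≤ a → ∃ u : ℝ → ℂ, IsWeilGroundState a u)
    (hRH : ¬ RiemannHypothesis) :
    ∃ a₀ : ℝ, ∃ u : ℝ → ℂ, IsWeilOnset a₀ ∧ Real.log 3 / 2 ≤ a₀ ∧ IsWeilGroundState a₀ u ∧
      (∫ t, ‖u t‖ ^ 2 = 1) ∧
      ∀ h : ℝ → ℂ, IsWeilTest h → tsupport h ⊆ Icc (-a₀) a₀ →
        weilFunctional (weilConv u (weilReflect h)) = 0 := by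
  obtain ⟨a₀, ha₀⟩ := exists_isWeilOnset_of_not_riemannHypothesis hRH
  obtain ⟨u, hu⟩ := hex a₀ ha₀.log_three_half_le
  exact ⟨a₀, u, ha₀, ha₀.log_three_half_le, hu, hu.integral_norm_sq,
    fun h hh hhs ↦ weilFunctional_weilConv_eq_zero_of_onset ha₀ hu hh hhs⟩

/-- **Criterion (injectivity of the truncated Weil convolution).**  If ground states exist on every
window `a ≥ log 3 / 2` (Bombieri 2000, Thm. 3; hypothesis) and, on each such window, every `u ∈ L²`
vanishing a.e. off `[-a, a]` with `W(u ⋆ h̃) = 0` for all window tests `h` vanishes a.e., then the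
Riemann hypothesis holds. [new] -/
theorem riemannHypothesis_of_weilConv_injective
    (hex : ∀ a : ℝ, Real.log 3 / 2 ≤ a → ∃ u : ℝ → ℂ, IsWeilGroundState a u)
    (hinj : ∀ a : ℝ, Real.log 3 / 2 ≤ a → ∀ u : ℝ → ℂ, MemLp u 2 →
      (∀ᵐ t : ℝ, t ∉ Icc (-a) a → u t = 0) →
      (∀ h : ℝ → ℂ, IsWeilTest h → tsupport h ⊆ Icc (-a) a →
        weilFunctional (weilConv u (weilReflect h)) = 0) →
      u =ᵐ[volume] 0) :
    RiemannHypothesis := by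
  by_contra hRH
  obtain ⟨a₀, u, ha₀, hl, hu, hnorm, hnull⟩ := exists_weilWindowNull_of_not_riemannHypothesis hex hRH
  have hae := hinj a₀ hl u hu.memLp hu.ae_eq_zero_of_notMem hnull
  have h0 : ∫ t, ‖u t‖ ^ 2 = (0 : ℝ) := by
    rw [integral_congr_ae (hae.mono fun t ht ↦ by rw [ht]) ]
    simp
  rw [h0] at hnorm
  exact zero_ne_one hnorm

/-- The criterion with ground states supplied by the compactness claim CCM25 Thm. 3.6. [new] -/
theorem riemannHypothesis_of_ccm36_of_weilConv_injective (h36 : ConnesConsaniMoscovici2025_thm_3_6)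
    (hinj : ∀ a : ℝ, Real.log 3 / 2 ≤ a → ∀ u : ℝ → ℂ, MemLp u 2 →
      (∀ᵐ t : ℝ, t ∉ Icc (-a) a → u t = 0) →
      (∀ h : ℝ → ℂ, IsWeilTest h → tsupport h ⊆ Icc (-a) a →
        weilFunctional (weilConv u (weilReflect h)) = 0) →
      u =ᵐ[volume] 0) :
    RiemannHypothesis :=
  riemannHypothesis_of_weilConv_injective
    (fun a ha ↦ h36.exists_isWeilGroundState
      ((div_pos (Real.log_pos (by norm_num)) two_pos).trans_le ha)) hinj

/-- Summit form of the criterion. [new] -/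
theorem summit_of_weilConv_injective
    (hex : ∀ a : ℝ, Real.log 3 / 2 ≤ a → ∃ u : ℝ → ℂ, IsWeilGroundState a u)
    (hinj : ∀ a : ℝ, Real.log 3 / 2 ≤ a → ∀ u : ℝ → ℂ, MemLp u 2 →
      (∀ᵐ t : ℝ, t ∉ Icc (-a) a → u t = 0) →
      (∀ h : ℝ → ℂ, IsWeilTest h → tsupport h ⊆ Icc (-a) a →
        weilFunctional (weilConv u (weilReflect h)) = 0) →
      u =ᵐ[volume] 0) :
    Summit.RiemannHypothesis :=
  riemannHypothesis_of_weilConv_injective hex hinj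

end Summit.RiemannHypothesis.RiemannHypothesis.Theorems
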